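import Mathlib.Analysis.InnerProductSpace.PiL2
import Mathlib.Analysis.SpecialFunctions.Pow.Real
import HarnessLib

/-!
# Crux K2 `PoloidalWindowRigidity` (stmt-NavierStokesRegularity-19708), line `z_shock` — R3 inhabitant census: ROTATING PATTERNS (XV) —
# every rotating profile equation is of MIXED TYPE: elliptic in the disc `|y| < √γlo/|ω|`, hyperbolic outside `|y| > √γhi/|ω|`, and the
# characteristic directions `y ∓ c·Jy` of the exterior system are OUTGOING (radial component `|y|²`)

`--supports stmt-NavierStokesRegularity-19708 --as helper` (leafhand-ns-poloidalwindowdoor-3 g9, cell decomp-ns, 2026-08-31).  Class-free,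
def-free, Mathlib only.  **No stub and no summit is closed by this file; Navier–Stokes regularity is NOT proved here (rung 0).**

WHY THIS FILE.  Evidence #47 §2(a): with `0 < γlo ≤ γ ≤ γhi` and `ω ≠ 0` the symbol `m = ω²|y|² − γ(Ψ)` of the rotating profile equation
(`X(γXΨ) = Θ(mΘΨ)`, part II) changes sign on every profile — there is NO uniformly hyperbolic sub-case (unlike the oblique profiles), the problem
is transonic with the elliptic region inside the sonic annulus `√γlo/|ω| ≤ |y| ≤ √γhi/|ω|`.  Parts XII–XIV work in the hyperbolic exterior under
the pointwise hypothesis `γ(Ψ(y)) < ω²|y|²`; this file records the elementary geometry that produces it and the outgoing character of the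
characteristic directions used by census item F3:

* `exterior_hyperbolic` — `γ ≤ γhi`, `√γhi < |ω|·‖y‖` ⟹ `γ(Ψ y) < ω²‖y‖²`;  `interior_elliptic` — `γlo ≤ γ`, `|ω|·‖y‖ < √γlo` ⟹ `ω²‖y‖² < γ(Ψ y)`;
* `inner_J_self`, `norm_J` — `⟪Jy, y⟫ = 0`, `‖Jy‖ = ‖y‖` for `Jy = (−y₁, y₀)`;
* ★ `radial_component_characteristic` — `⟪y − c·Jy, y⟫ = ‖y‖²`: along the characteristic fields `X ∓ (λ/γ(Ψ))Θ` (direction `y ∓ cJy` at `y`)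
  the radius increases strictly away from the origin — the exterior problem is a genuine FORWARD evolution in `r` (one-sidedness used by
  `…ZShockRiccatiForced`).

[folklore]
-/

noncomputable section

namespace Summit.NavierStokesRegularity.NavierStokesRegularity.Theorems.PoloidalWindowDoorPoloidalWindowRigidityZShockRotatingProfileMixedType

-- the summit and its single sub-problem share the name (CONVENTIONS §1)
set_option linter.dupNamespace false

open Set Filter Topology

variable {J : EuclideanSpace ℝ (Fin 2) → EuclideanSpace ℝ (Fin 2)}

/-- **Hyperbolic exterior**: `γ ≤ γhi` and `√γhi < |ω|‖y‖` give `γ(s) < ω²‖y‖²` for every state `s`. [folklore] -/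
theorem exterior_hyperbolic {γ : ℝ → ℝ} {γhi ω : ℝ} (hγhi : ∀ s, γ s ≤ γhi) (hγhi0 : 0 ≤ γhi)
    (y : EuclideanSpace ℝ (Fin 2)) (hy : Real.sqrt γhi < |ω| * ‖y‖) (s : ℝ) : γ s < ω ^ 2 * ‖y‖ ^ 2 := by
  have h1 : γhi < (|ω| * ‖y‖) ^ 2 := by
    have h0 : 0 ≤ Real.sqrt γhi := Real.sqrt_nonneg _
    have h2 : Real.sqrt γhi ^ 2 < (|ω| * ‖y‖) ^ 2 := by
      exact pow_lt_pow_left₀ hy h0 two_ne_zero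
    rwa [Real.sq_sqrt hγhi0] at h2
  have h3 : (|ω| * ‖y‖) ^ 2 = ω ^ 2 * ‖y‖ ^ 2 := by rw [mul_pow, sq_abs]
  linarith [hγhi s, h3 ▸ h1]

/-- **Elliptic disc**: `γlo ≤ γ` and `|ω|‖y‖ < √γlo` give `ω²‖y‖² < γ(s)` for every state `s`. [folklore] -/
theorem interior_elliptic {γ : ℝ → ℝ} {γlo ω : ℝ} (hγlo : ∀ s, γlo ≤ γ s)
    (y : EuclideanSpace ℝ (Fin 2)) (hy : |ω| * ‖y‖ < Real.sqrt γlo) (s : ℝ) : ω ^ 2 * ‖y‖ ^ 2 < γ s := by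
  have h0 : 0 ≤ |ω| * ‖y‖ := by positivity
  have hγlo0 : 0 < γlo := by
    have : 0 < Real.sqrt γlo := h0.trans_lt hy
    exact Real.sqrt_pos.1 this
  have h2 : (|ω| * ‖y‖) ^ 2 < Real.sqrt γlo ^ 2 := pow_lt_pow_left₀ hy h0 two_ne_zero
  rw [Real.sq_sqrt hγlo0.le, mul_pow, sq_abs] at h2
  linarith [hγlo s]

/-- `⟪Jy, y⟫ = 0` for the rotation generator `Jy = (−y₁, y₀)`. [folklore] -/
theorem inner_J_self (hJ : ∀ y' : EuclideanSpace ℝ (Fin 2), J y' = (-(y' 1)) • EuclideanSpace.single (0 : Fin 2) (1 : ℝ) +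
      (y' 0) • EuclideanSpace.single (1 : Fin 2) (1 : ℝ)) (y : EuclideanSpace ℝ (Fin 2)) :
    inner ℝ (J y) y = 0 := by
  rw [hJ, EuclideanSpace.inner_eq_star_dotProduct]
  simp [Fin.sum_univ_two, dotProduct]
  ring

/-- `‖Jy‖ = ‖y‖`. [folklore] -/
theorem norm_J (hJ : ∀ y' : EuclideanSpace ℝ (Fin 2), J y' = (-(y' 1)) • EuclideanSpace.single (0 : Fin 2) (1 : ℝ) +
      (y' 0) • EuclideanSpace.single (1 : Fin 2) (1 : ℝ)) (y : EuclideanSpace ℝ (Fin 2)) :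
    ‖J y‖ = ‖y‖ := by
  have h1 : ‖J y‖ ^ 2 = ‖y‖ ^ 2 := by
    rw [EuclideanSpace.norm_sq_eq, EuclideanSpace.norm_sq_eq, hJ]
    simp [Fin.sum_univ_two]
    ring
  have h2 := abs_eq_abs.2 (Or.inl rfl : ‖J y‖ = ‖J y‖ ∨ ‖J y‖ = -‖J y‖)
  nlinarith [norm_nonneg (J y), norm_nonneg y, h1]

/-- ★ **Characteristic directions are outgoing**: `⟪y − c·Jy, y⟫ = ‖y‖²` for every real `c` — along the characteristic fields
`X ∓ (λ/γ(Ψ))Θ` of the exterior system (direction `y ∓ cJy` at the point `y`) the radius increases strictly off the origin. [folklore] -/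
theorem radial_component_characteristic
    (hJ : ∀ y' : EuclideanSpace ℝ (Fin 2), J y' = (-(y' 1)) • EuclideanSpace.single (0 : Fin 2) (1 : ℝ) +
      (y' 0) • EuclideanSpace.single (1 : Fin 2) (1 : ℝ)) (y : EuclideanSpace ℝ (Fin 2)) (c : ℝ) :
    inner ℝ (y - c • J y) y = ‖y‖ ^ 2 := by
  rw [inner_sub_left, inner_smul_left, inner_J_self hJ y, real_inner_self_eq_norm_sq]
  simp

end Summit.NavierStokesRegularity.NavierStokesRegularity.Theorems.PoloidalWindowDoorPoloidalWindowRigidityZShockRotatingProfileMixedType
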